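import Summits.HodgeConjecture.HodgeConjecture.Theorems.MarkmanPartnerTransportK3Sq2TypeHodgeGraphClassesGeneral
import Summits.HodgeConjecture.HodgeConjecture.Theorems.Ring2HypothesesDescentAlgebraicCorrespondencesJannsen
import Literature.AlgebraicGeometry.HodgeTheory.KunnethComponentsDiagonalAction
import Literature.AlgebraicGeometry.HodgeTheory.AlgebraicClassesPullbackHolds
import HarnessLib

/-!
# Route MarkmanPartnerTransport · T3C «KAPPA-TO-CORR»: a `q`-self-adjoint endomorphism of `H²(X)` with
# ALGEBRAIC kappa class is CYCLE-INDUCED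

Sub-problem `HodgeConjecture`, route MarkmanPartnerTransport, cell hodge-nonav (memo ROUTE-P1AJ §C r8, target T3C of
`Sketch_P1AJ_OrphanSR_g37` r3). For a marked smooth projective `K3^{[2]}`-type fourfold `(X, φ, P, z)` and a
`q`-SELF-ADJOINT `ℂ`-linear endomorphism `g` of `H²(X(ℂ); ℂ)` whose kappa class
`κ_g = Σᵢⱼ (G⁻¹)ᵢⱼ · φ⁻¹eᵢ ∪ g(φ⁻¹eⱼ)` is algebraic, `g = [Z]_*` for an algebraic class `Z ∈ A⁴(X × X)`
(`exists_corrAction_eq_of_kappaClass`); modulo {Verbitsky–Guan, Charles–Markman 2013} (through the tree's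
`qInvAlgebraic_of_charlesMarkman`: the inverse Beauville–Bogomolov class `Q_X ∈ A²(X × X)`). This is the converse
of the tree's bookkeeping `κ_{[Z]_*} = pr_{1*}(Q_X ∪ Z)` (`kappaClass_eq_complexGysin_qInvClass_cup`).

Proof (no composition of correspondences). `κ_g` is a graph class for `g`: `(κ_g ∪ y) ∪ w =
(t·q(y,w) + q(gy,w) + q(gw,y))·P` (`exists_graphClass_of_kappaClass`). The algebraic class
`Z' := Q_X ∪ pr₂^* κ_g ∈ A⁴(X × X)` (Charles–Markman for `Q_X`, pull-back and product of algebraic classes are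
algebraic — tree theorems) is the sum of cross products `Σ (G⁻¹)ᵢⱼ · pr₁^* αᵢ ∪ pr₂^*(αⱼ ∪ κ_g)`, each acting on
`H²` as the rank-one operator `c ↦ ∫(c ∪ αⱼ ∪ κ_g) · αᵢ` (`corrAction_cross_eq_smulRight`, `∫ = ` the fibre
integral `p₁₊ p₂^*`); by the cubic and self-adjointness `∫((κ_g ∪ αⱼ) ∪ c) = ∫P · q(eⱼ, φ(t c + 2 g c))`, and the
inverse Gram matrix contracts `Σᵢⱼ (G⁻¹)ᵢⱼ q(eⱼ, v) αᵢ = φ⁻¹ v`, so `[Z']_* = ∫P · (t + 2g)` with `∫P ≠ 0`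
(`exists_fibreIntegral_ne_zero`); finally `Z := (2∫P)⁻¹ (Z' − t ∫P [Δ])`, `[Δ]_* = id`.

CONDITIONAL on the two named facts displayed; no definition, no sorry; credits nothing to the Hodge conjecture.
Prover seat hodge-nonav-20241-p1 (gen 13), `--supports stmt-HodgeConjecture-19653`.

References: K. O'Grady, Commun. Contemp. Math. 10 (2008) §2; F. Charles, E. Markman, Compos. Math. 149 (2013)
Thm. 1.1; S. Kleiman, in *Dix exposés* (1968) Prop. 1.3.6; W. Fulton, *Young Tableaux* App. B (5)–(6);
C. Voisin, *Hodge Theory II*, proof of Thm. 10.17.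
-/

noncomputable section

set_option linter.dupNamespace false

open Module CategoryTheory MonoidalCategory CartesianMonoidalCategory
open Literature.AlgebraicTopology.SingularHomology Literature.Geometry.Kaehler
open Literature.AlgebraicGeometry Literature.AlgebraicGeometry.Motives Literature.AlgebraicGeometry.HodgeTheory
open Literature.AlgebraicGeometry.Hyperkaehler Literature.AlgebraicGeometry.Surfaces
open Summit.HodgeConjecture.HodgeConjecture.Theorems.MarkmanPartnerTransport.BBFPositivity

namespace Summit.HodgeConjecture.HodgeConjecture.Theorems.MarkmanPartnerTransport.PartnerLattice

/-- `MarkedK3Sq[X, φ, P, z]`: VERBATIM the `let MarkedK3Sq := …` binder of the route declarations of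
MarkmanPartnerTransport (clauses (m1)–(m6)). Local notation only. -/
local notation3 (prettyPrint := false) "MarkedK3Sq[" X ", " φ ", " P ", " z "]" =>
  (((IsIntegralClass P ∧ ∀ Q : complexBetti X (2 * 4), IsIntegralClass Q → ∃ n : ℤ, Q = n • P) ∧
    (∀ c : complexBetti X 2, IsIntegralClass c ↔ ∃ v : K3HilbertIndex → ℤ, φ c = fun i => (v i : ℂ)) ∧
    (∀ a : complexBetti X 2, cupPowTwo a 4 = ((3 : ℂ) * (k3HilbertForm 2 (φ a) (φ a)) ^ 2) • P) ∧
    (IsOfHodgeType 4 X 2 2 0 (LinearEquiv.symm φ z) ∧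
      ∀ τ : complexBetti X 2, IsOfHodgeType 4 X 2 2 0 τ → ∃ t : ℂ, τ = t • LinearEquiv.symm φ z) ∧
    (∀ c : complexBetti X 2, IsOfHodgeType 4 X 2 1 1 c ↔
      (k3HilbertForm 2 (φ c) z = 0 ∧ k3HilbertForm 2 (φ c) (star z) = 0)) ∧
    (k3HilbertForm 2 z z = 0 ∧ 0 < (k3HilbertForm 2 (star z) z).re)))

/-- `Cup3[c, y, w] = (c ∪ y) ∪ w ∈ H⁸` for `c ∈ H⁴`, `y, w ∈ H²`. Local notation only. -/
local notation3 (prettyPrint := false) "Cup3[" c ", " y ", " w "]" =>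
  cupProduct (rfl : 2 * 3 + 2 = 2 * 4) (cupProduct (rfl : 2 * 2 + 2 = 2 * 3) c y) w

/-- `Kap[φ, g] = Σ_{ij} (G⁻¹)_{ij} · φ⁻¹eᵢ ∪ g(φ⁻¹eⱼ) ∈ H⁴(X(ℂ); ℂ)`, the kappa class of an endomorphism `g`
of `H²(X(ℂ); ℂ)` (VERBATIM `…K3Sq2TypeHodgeGraphClassesGeneral`). Local notation only. -/
local notation3 (prettyPrint := false) "Kap[" φ ", " g "]" =>
  (∑ i : K3HilbertIndex, ∑ j : K3HilbertIndex,
    (((k3HilbertGram 2).map (Int.cast : ℤ → ℂ))⁻¹ i j) •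
      cupProduct (rfl : 2 + 2 = 2 * 2) ((LinearEquiv.symm φ) (Pi.single i 1))
        (g ((LinearEquiv.symm φ) (Pi.single j 1))))

variable {X : SchemeOver ℂ} {φ : complexBetti X 2 ≃ₗ[ℂ] (K3HilbertIndex → ℂ)} {P : complexBetti X (2 * 4)}
  {z : K3HilbertIndex → ℂ}

/-! ### The inverse Gram matrix is symmetric and contracts `q` to coordinates (row form) -/

/-- `(G⁻¹)ᵢⱼ = (G⁻¹)ⱼᵢ` for the Beauville–Bogomolov Gram matrix of `K3^{[2]}`-type on `ℂ²³` (`G` is symmetric).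
[cite: OGrady2008NumericalK3Square, §2.1 (2.1.2)] -/
theorem k3HilbertGramInv_map_apply_comm (i j : K3HilbertIndex) :
    ((k3HilbertGram 2).map (Int.cast : ℤ → ℂ))⁻¹ i j = ((k3HilbertGram 2).map (Int.cast : ℤ → ℂ))⁻¹ j i := by
  have hGsymm : ((k3HilbertGram 2).map (Int.cast : ℤ → ℂ)).transpose = (k3HilbertGram 2).map (Int.cast : ℤ → ℂ) := by
    rw [← Matrix.transpose_map, k3HilbertGram_transpose]
  have h : (((k3HilbertGram 2).map (Int.cast : ℤ → ℂ))⁻¹).transpose =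
      ((k3HilbertGram 2).map (Int.cast : ℤ → ℂ))⁻¹ := by
    rw [Matrix.transpose_nonsing_inv, hGsymm]
  have hij := congrFun (congrFun h i) j
  rw [Matrix.transpose_apply] at hij
  exact hij.symm

/-- **`Σⱼ (G⁻¹)ᵢⱼ q(eⱼ, v) = vᵢ`** (row form of `sum_gramInv_k3HilbertForm_single_eq`, by symmetry of `G⁻¹`).
[cite: OGrady2008NumericalK3Square, §2.1 (2.1.2)] -/
theorem sum_gramInv_k3HilbertForm_single_eq_row (v : K3HilbertIndex → ℂ) (i : K3HilbertIndex) :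
    ∑ j, ((k3HilbertGram 2).map (Int.cast : ℤ → ℂ))⁻¹ i j * k3HilbertForm 2 (Pi.single j 1) v = v i := by
  rw [← sum_gramInv_k3HilbertForm_single_eq v i]
  exact Finset.sum_congr rfl fun j _ => by rw [k3HilbertGramInv_map_apply_comm i j]


/-! ### `Q_X ∪ pr₂^* c` is a sum of cross products -/

/-- **`Q_X ∪ pr₂^* c = Σᵢⱼ (G⁻¹)ᵢⱼ · pr₁^* αᵢ ∪ pr₂^*(αⱼ ∪ c)`** for `c ∈ H⁴(X(ℂ); ℂ)` (bilinearity and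
associativity of the cup product, multiplicativity of `pr₂^*`). [cite: HatcherAT2002, §3.2 Prop. 3.10 and p. 211] -/
theorem qInvClass_cup_map_snd_eq_sum (cg : complexBetti X (2 * 2)) :
    cupProduct (two_mul_add_two_mul 2 2) (qInvClass φ) (complexBetti.map (snd X X) (2 * 2) cg) =
      ∑ i : K3HilbertIndex, ∑ j : K3HilbertIndex,
      (((k3HilbertGram 2).map (Int.cast : ℤ → ℂ))⁻¹ i j) •
        cupProduct (rfl : 2 + 2 * 3 = 2 * 4) (complexBetti.map (fst X X) 2 (φ.symm (Pi.single i 1)))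
          (complexBetti.map (snd X X) (2 * 3)
            (cupProduct (rfl : 2 + 2 * 2 = 2 * 3) (φ.symm (Pi.single j 1)) cg)) := by
  rw [qInvClass, map_sum, LinearMap.sum_apply]
  refine Finset.sum_congr rfl fun i _ => ?_
  rw [map_sum, LinearMap.sum_apply]
  refine Finset.sum_congr rfl fun j _ => ?_
  rw [map_smul, LinearMap.smul_apply, cupProduct_assoc (rfl : 2 + 2 = 2 * 2) (rfl : 2 + 2 * 2 = 2 * 3)
      (two_mul_add_two_mul 2 2) (show 2 + 2 * 3 = 2 * (2 + 2) by norm_num), ← complexBetti.map_cupProduct]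

/-- `c ∪ (a ∪ x) = (x ∪ a) ∪ c` for `a, c ∈ H²`, `x ∈ H⁴` (graded commutativity in even degrees).
[cite: HatcherAT2002, §3.2 Thm. 3.11] -/
theorem cupProduct_cupProduct_eq_cup3 (cg : complexBetti X (2 * 2)) (c a : complexBetti X 2) :
    cupProduct (rfl : 2 + 2 * 3 = 2 * 4) c (cupProduct (rfl : 2 + 2 * 2 = 2 * 3) a cg) = Cup3[cg, a, c] := by
  rw [cupProduct_gradedComm_holds ℂ (ComplexPoints X) (rfl : 2 + 2 * 2 = 2 * 3) (rfl : 2 * 2 + 2 = 2 * 3) a cg,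
    map_smul, cupProduct_gradedComm_holds ℂ (ComplexPoints X) (rfl : 2 + 2 * 3 = 2 * 4)
      (rfl : 2 * 3 + 2 = 2 * 4) c _]
  norm_num


/-! ### T3C: cycle-induced from an algebraic kappa class -/

/-- **(T3C) `KAPPA-TO-CORR`.** For a marked smooth projective `K3^{[2]}`-type `X` and a `q`-SELF-ADJOINT endomorphism
`g` of `H²(X(ℂ); ℂ)` whose kappa class is algebraic, `g` is CYCLE-INDUCED: `g = [Z]_*` for an algebraic
`Z ∈ A⁴(X × X)` (complex orientations). `Z = (2∫P)⁻¹ · (Q_X ∪ pr₂^* κ_g − t ∫P · [Δ])`, where `Q_X ∪ pr₂^* κ_g =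
Σ (G⁻¹)ᵢⱼ pr₁^* αᵢ ∪ pr₂^*(αⱼ ∪ κ_g)` acts as `∫P · (t + g + g†) = ∫P · (t + 2g)` by the cubic of the graph class
`κ_g` and the contraction `Σᵢⱼ (G⁻¹)ᵢⱼ q(eⱼ, v) αᵢ = φ⁻¹v`. Modulo {Verbitsky–Guan, Charles–Markman 2013}
(`Q_X` algebraic). [cite: CharlesMarkman2013, Thm. 1.1 (§1)] [cite: Kleiman1968AlgebraicCycles, §1.3 Prop. 1.3.6]
[cite: OGrady2008NumericalK3Square, §2.2 Remark 2.1] -/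
theorem exists_corrAction_eq_of_kappaClass
    (hV : VerbitskyGuan_cohomology_K3HilbertSquareType) (hB : CharlesMarkman2013_lefschetzStandard_K3HilbertType)
    (hX : IsSmoothProjective 4 X) (hK : IsOfK3HilbertSquareType X) (hM : MarkedK3Sq[X, φ, P, z])
    (g : complexBetti X 2 →ₗ[ℂ] complexBetti X 2)
    (hsa : ∀ y w : complexBetti X 2, k3HilbertForm 2 (φ (g y)) (φ w) = k3HilbertForm 2 (φ y) (φ (g w)))
    (hκ : Kap[φ, g] ∈ algebraicClasses X 2) :
    ∃ Z ∈ algebraicClasses (X ⊗ X) 4, ∀ y : complexBetti X 2,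
      g y = corrAction complexOrientationFamily hX hX (rfl : 2 + 2 * 4 = 2 + 2 * 4) Z y := by
  classical
  have hXX : IsSmoothProjective (4 + 4) (X ⊗ X) := IsSmoothProjective.tensor_holds hX hX
  have hP : P ≠ 0 := generator_ne_zero_of_markedSq hX hM
  obtain ⟨cg, hcg, t, hcub⟩ := exists_graphClass_of_kappaClass hM g hκ
  obtain ⟨fI, hfI⟩ := exists_fibreIntegral complexOrientationFamily hX
  have hfIP : fI P ≠ 0 := by
    obtain ⟨w₀, hw₀⟩ := exists_fibreIntegral_ne_zero complexOrientationFamily hX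
    obtain ⟨s, hs⟩ := Literature.AlgebraicGeometry.HodgeTheory.exists_eq_smul_of_top complexOrientationFamily hX hP w₀
    intro h0
    apply hw₀
    rw [hfI, hs, map_smul, smul_eq_mul, h0, mul_zero, zero_smul]
  have hZ'alg2 := Theorems.Voisin2003_cupProduct_algebraicClasses_holds hXX
      (qInvAlgebraic_of_charlesMarkman hV hB X hX hK φ P z hM)
      (fulton1998_map_mem_algebraicClasses_holds' (snd X X) hX hXX 2 cg hcg)
  have hZ'alg : cupProduct (two_mul_add_two_mul 2 2) (qInvClass φ) (complexBetti.map (snd X X) (2 * 2) cg) ∈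
      algebraicClasses (X ⊗ X) 4 := hZ'alg2
  have hterm : ∀ (c : complexBetti X 2) (j : K3HilbertIndex),
      fI (cupProduct (rfl : 2 + 2 * 3 = 2 * 4) c
        (cupProduct (rfl : 2 + 2 * 2 = 2 * 3) (φ.symm (Pi.single j 1)) cg)) =
        fI P * k3HilbertForm 2 (Pi.single j 1) (φ ((t : ℂ) • c + (2 : ℂ) • g c)) := by
    intro c j
    rw [cupProduct_cupProduct_eq_cup3, hcub, map_smul, smul_eq_mul, LinearEquiv.apply_symm_apply, hsa, LinearEquiv.apply_symm_apply,
      k3HilbertForm_comm 2 (φ (g c)) (Pi.single j 1), map_add, map_smul, map_smul, k3HilbertForm_add_right,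
      k3HilbertForm_smul_right, k3HilbertForm_smul_right]
    ring
  -- the action of `Z'`: `∫P · (t + 2g)`
  have hact : ∀ c : complexBetti X 2, corrAction complexOrientationFamily hX hX (rfl : 2 + 2 * 4 = 2 + 2 * 4)
      (cupProduct (two_mul_add_two_mul 2 2) (qInvClass φ) (complexBetti.map (snd X X) (2 * 2) cg)) c =
      fI P • ((t : ℂ) • c + (2 : ℂ) • g c) := by
    intro c
    calc corrAction complexOrientationFamily hX hX (rfl : 2 + 2 * 4 = 2 + 2 * 4)
          (cupProduct (two_mul_add_two_mul 2 2) (qInvClass φ) (complexBetti.map (snd X X) (2 * 2) cg)) c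
        = ∑ i : K3HilbertIndex, ∑ j : K3HilbertIndex, (((k3HilbertGram 2).map (Int.cast : ℤ → ℂ))⁻¹ i j) •
            (fI (cupProduct (rfl : 2 + 2 * 3 = 2 * 4) c
              (cupProduct (rfl : 2 + 2 * 2 = 2 * 3) (φ.symm (Pi.single j 1)) cg)) •
                φ.symm (Pi.single i 1)) := by
          rw [qInvClass_cup_map_snd_eq_sum, map_sum, LinearMap.sum_apply]
          refine Finset.sum_congr rfl fun i _ => ?_
          rw [map_sum, LinearMap.sum_apply]
          refine Finset.sum_congr rfl fun j _ => ?_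
          rw [map_smul, LinearMap.smul_apply,
            corrAction_cross_eq_smulRight complexOrientationFamily hX (rfl : 2 + 2 * 3 = 2 * 4) even_two hfI,
            LinearMap.smulRight_apply, LinearMap.comp_apply, LinearMap.flip_apply]
      _ = ∑ i : K3HilbertIndex, (fI P * φ ((t : ℂ) • c + (2 : ℂ) • g c) i) • φ.symm (Pi.single i 1) := by
          refine Finset.sum_congr rfl fun i _ => ?_
          simp_rw [hterm, smul_smul, ← Finset.sum_smul]
          congr 1
          rw [← sum_gramInv_k3HilbertForm_single_eq_row (φ ((t : ℂ) • c + (2 : ℂ) • g c)) i, Finset.mul_sum]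
          exact Finset.sum_congr rfl fun j _ => by ring
      _ = fI P • ((t : ℂ) • c + (2 : ℂ) • g c) := by
          conv_rhs => rw [eq_sum_smul_symm_single φ ((t : ℂ) • c + (2 : ℂ) • g c), Finset.smul_sum]
          exact Finset.sum_congr rfl fun i _ => by rw [smul_smul]
  -- normalise: `Z = (2∫P)⁻¹ (Z' − t∫P [Δ])`
  refine ⟨(2 * fI P)⁻¹ • (cupProduct (two_mul_add_two_mul 2 2) (qInvClass φ)
      (complexBetti.map (snd X X) (2 * 2) cg) - (fI P * t) • diagonalClass hX), ?_, fun y => ?_⟩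
  · exact Submodule.smul_mem _ _ (Submodule.sub_mem _ hZ'alg
      (Submodule.smul_mem _ _ (diagonalClass_mem_algebraicClasses hX)))
  · rw [map_smul, map_sub, map_smul, LinearMap.smul_apply, LinearMap.sub_apply, LinearMap.smul_apply, hact,
      corrAction_diagonalClass_apply hX]
    have h2 : (2 * fI P) ≠ 0 := mul_ne_zero two_ne_zero hfIP
    rw [smul_add, smul_smul, smul_smul, add_sub_cancel_left, smul_smul, mul_comm (fI P) 2, inv_mul_cancel₀ h2,
      one_smul]

end Summit.HodgeConjecture.HodgeConjecture.Theorems.MarkmanPartnerTransport.PartnerLattice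

end
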